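import Mathlib.Analysis.SpecialFunctions.Pow.Asymptotics
import Mathlib.Analysis.SpecialFunctions.Log.Basic
import HarnessLib

/-!
# Scales `X^a (log X)^b` and their eventual comparison (toolkit for Diaz 1989, §II-4)

Topic `Literature/NumberTheory/Transcendental` (trunk T-TRANSCEND). Decomposition step for the
named fact `Literature.NumberTheory.Transcendental.Diaz1989_thm1` (`DiazMain.lean`). The choice of parameters in §II-4
of G. Diaz, J. Number Theory 31 (1989), p. 15 (`D = [X^{m+n}(log X)^{-n/(n+1)}]`,
`L = a₁[X^{m-1}(log X)^{1/(n+1)}]`, `M = [X^{n+1}]`, `ρ = 8(n+1)X^{m(n+1)} log X`, …) makes every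
quantity of the proof a constant multiple of a *scale* `X^a (log X)^b`, and every constraint
(𝒞1)–(𝒞9), as well as the growth conditions of Philippon's criterion, an eventual inequality between
two such scales, decided by the lexicographic order of `(a, b)` — the fractional powers of `log X`
are exactly what produces the "`+1`" of Diaz's theorem. This file provides that bookkeeping once
and for all (everything here is proved):

* `scale a b X = X^a (log X)^b` (real powers), positivity, products and powers;
* `eventually_mul_scale_le_of_lt` (`a < a'`: `C X^a(log X)^b ≤ X^{a'}(log X)^{b'}` eventually, any
  `C`), `eventually_mul_scale_le_of_lt_right` (`a = a'`, `b < b'`), `scale_le_scale` (monotonicity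
  in the exponents for `X ≥ e`), `eventually_const_le_scale`.
(Integer parts are handled at the use sites with Mathlib's `Nat.floor_le` / `Nat.lt_floor_add_one`.)

## References

* G. Diaz, *Grands degrés de transcendance pour des familles d'exponentielles*, J. Number Theory
  31 (1989), 1–23, §II-4-1, p. 15 (choice of parameters).
-/

noncomputable section

open Filter Real Asymptotics

namespace Literature.NumberTheory.Transcendental

namespace Asymp

/-- The scale `X^a (log X)^b` (a generic bookkeeping device; Diaz's parameters are constant multiples
of such scales). [folklore] -/
def scale (a b X : ℝ) : ℝ := X ^ a * Real.log X ^ b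

/-- Scales are positive for `X > 1`. [folklore] -/
theorem scale_pos {a b X : ℝ} (hX : 1 < X) : 0 < scale a b X := by
  unfold scale
  exact mul_pos (rpow_pos_of_pos (by linarith) _) (rpow_pos_of_pos (Real.log_pos hX) _)

/-- Scales are nonnegative for `X ≥ 1`. [folklore] -/
theorem scale_nonneg {a b X : ℝ} (hX : 1 ≤ X) : 0 ≤ scale a b X := by
  unfold scale
  exact mul_nonneg (rpow_nonneg (by linarith) _) (rpow_nonneg (Real.log_nonneg hX) _)

/-- Product of scales. [folklore] -/
theorem scale_mul_scale {a b a' b' X : ℝ} (hX : 1 < X) :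
    scale a b X * scale a' b' X = scale (a + a') (b + b') X := by
  unfold scale
  rw [rpow_add (by linarith), rpow_add (Real.log_pos hX)]
  ring

/-- Powers of scales. [folklore] -/
theorem scale_rpow {a b c X : ℝ} (hX : 1 ≤ X) : scale a b X ^ c = scale (a * c) (b * c) X := by
  unfold scale
  rw [mul_rpow (rpow_nonneg (by linarith) _) (rpow_nonneg (Real.log_nonneg hX) _),
    ← rpow_mul (by linarith), ← rpow_mul (Real.log_nonneg hX)]

/-- Natural powers of scales. [folklore] -/
theorem scale_pow {a b X : ℝ} (hX : 1 ≤ X) (k : ℕ) :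
    scale a b X ^ k = scale (a * k) (b * k) X := by
  rw [← rpow_natCast, scale_rpow hX]

/-- `scale 0 0 = 1`. [folklore] -/
@[simp] theorem scale_zero_zero (X : ℝ) : scale 0 0 X = 1 := by simp [scale]

/-- `scale 1 0 X = X`. [folklore] -/
theorem scale_one_zero (X : ℝ) : scale 1 0 X = X := by simp [scale, rpow_one]

/-- `scale 0 1 X = log X`. [folklore] -/
theorem scale_zero_one (X : ℝ) : scale 0 1 X = Real.log X := by simp [scale, rpow_one]

/-- **Monotonicity in the exponents** for `X ≥ e` (so that `log X ≥ 1`). [folklore] -/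
theorem scale_le_scale {a b a' b' X : ℝ} (ha : a ≤ a') (hb : b ≤ b') (hX : Real.exp 1 ≤ X) :
    scale a b X ≤ scale a' b' X := by
  have hX1 : 1 ≤ X := le_trans (by have := Real.add_one_le_exp (1 : ℝ); linarith) hX
  have hlog : 1 ≤ Real.log X := by
    rw [Real.le_log_iff_exp_le (by linarith)]; exact hX
  unfold scale
  exact mul_le_mul (rpow_le_rpow_of_exponent_le hX1 ha) (rpow_le_rpow_of_exponent_le hlog hb)
    (rpow_nonneg (by linarith) _) (rpow_nonneg (by linarith) _)

/-- **Eventual domination, different powers of `X`**: if `a < a'` then for every `C`,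
`C X^a (log X)^b ≤ X^{a'} (log X)^{b'}` for all large `X`. [folklore] -/
theorem eventually_mul_scale_le_of_lt {a a' : ℝ} (h : a < a') (b b' C : ℝ) :
    ∀ᶠ X in atTop, C * scale a b X ≤ scale a' b' X := by
  rcases le_or_gt C 0 with hC | hC
  · filter_upwards [eventually_ge_atTop (1 : ℝ)] with X hX
    exact le_trans (mul_nonpos_of_nonpos_of_nonneg hC (scale_nonneg hX)) (scale_nonneg hX)
  · have hlo := isLittleO_log_rpow_rpow_atTop (b - b') (sub_pos.mpr h)
    have hb := hlo.bound (inv_pos.mpr hC)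
    filter_upwards [hb, eventually_gt_atTop (1 : ℝ)] with X hXb hX1
    have hlogpos : 0 < Real.log X := Real.log_pos hX1
    have hXpos : 0 < X := by linarith
    rw [Real.norm_of_nonneg (rpow_nonneg hlogpos.le _), Real.norm_of_nonneg (rpow_nonneg hXpos.le _)]
      at hXb
    -- `C (log X)^{b-b'} ≤ X^{a'-a}`
    have h1 : C * Real.log X ^ (b - b') ≤ X ^ (a' - a) := by
      have := mul_le_mul_of_nonneg_left hXb hC.le
      rwa [← mul_assoc, mul_inv_cancel₀ hC.ne', one_mul] at this
    -- multiply by `X^a (log X)^{b'} > 0`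
    have hpos : 0 < X ^ a * Real.log X ^ b' := mul_pos (rpow_pos_of_pos hXpos _) (rpow_pos_of_pos hlogpos _)
    have := mul_le_mul_of_nonneg_right h1 hpos.le
    unfold scale
    calc C * (X ^ a * Real.log X ^ b) = C * Real.log X ^ (b - b') * (X ^ a * Real.log X ^ b') := by
          rw [show b = (b - b') + b' by ring, rpow_add hlogpos]; ring
      _ ≤ X ^ (a' - a) * (X ^ a * Real.log X ^ b') := this
      _ = X ^ a' * Real.log X ^ b' := by
          rw [← mul_assoc, ← rpow_add hXpos]; ring_nf

/-- **Eventual domination, same power of `X`**: if `b < b'` then for every `C`,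
`C X^a (log X)^b ≤ X^a (log X)^{b'}` for all large `X`. [folklore] -/
theorem eventually_mul_scale_le_of_lt_right (a : ℝ) {b b' : ℝ} (h : b < b') (C : ℝ) :
    ∀ᶠ X in atTop, C * scale a b X ≤ scale a b' X := by
  have ht : Tendsto (fun X : ℝ => Real.log X ^ (b' - b)) atTop atTop :=
    (tendsto_rpow_atTop (sub_pos.mpr h)).comp Real.tendsto_log_atTop
  filter_upwards [ht.eventually_ge_atTop C, eventually_gt_atTop (1 : ℝ)] with X hXC hX1
  have hlogpos : 0 < Real.log X := Real.log_pos hX1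
  have hXpos : 0 < X := by linarith
  unfold scale
  have hpos : 0 < X ^ a * Real.log X ^ b := mul_pos (rpow_pos_of_pos hXpos _) (rpow_pos_of_pos hlogpos _)
  calc C * (X ^ a * Real.log X ^ b) ≤ Real.log X ^ (b' - b) * (X ^ a * Real.log X ^ b) :=
        mul_le_mul_of_nonneg_right hXC hpos.le
    _ = X ^ a * Real.log X ^ b' := by
        rw [show b' = (b' - b) + b by ring, rpow_add hlogpos]; ring

/-- Constants are eventually below any scale with `a > 0`, or `a = 0 < b`. [folklore] -/
theorem eventually_const_le_scale {a b : ℝ} (h : 0 < a ∨ (a = 0 ∧ 0 < b)) (C : ℝ) :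
    ∀ᶠ X in atTop, C ≤ scale a b X := by
  rcases h with ha | ⟨rfl, hb⟩
  · have := eventually_mul_scale_le_of_lt ha 0 b C
    filter_upwards [this] with X hX
    simpa using hX
  · have := eventually_mul_scale_le_of_lt_right 0 hb C
    filter_upwards [this] with X hX
    simpa using hX

end Asymp

end Literature.NumberTheory.Transcendental

end
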